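import Mathlib
import Summits.HodgeConjecture.FermatCycles.HodgeFermatPropL7aB
import Summits.HodgeConjecture.FermatCycles.HodgeFermatTheoremL13
import Summits.HodgeConjecture.FermatCycles.HodgeFermatPropZ5B

/-!
# THEOREM D6 — the assembly (`tables/KR-FREE.md` §7), modulo PROPOSITION L7(c) and THEOREM U — part 1 (`HodgeFermat/TheoremD6.lean`; HF-G21g)

Tree copy (part 1 of 2) of the module `HodgeFermat/TheoremD6.lean` of the sibling cell's standalone package
`run/shared/lean/pub/pub-hodgefermat/lean/HodgeFermat/` (564 lines, sha256 `acde7c49261755f7…`), source lines 56–287 (§0 statements `NotIn`/`Disj`/`JP`/`D6`/`PropL7c`/`ThmU`, §1 divisibility lemmas, §2 the `Setting` and its symmetries, §3 the finite levels `fact_contra`).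
Filed by cell `pub-hfermat`, seat prover-1 gen-3, on the COORDINATOR KEEPER RULING of 2026-08-25 (gem sweep H1: take the
off-gate kernel theorem `thmFstar` through the gate) — here THEOREM F* of `tables/DPRIME-THEOREM.md` §9 IN FULL, i.e.
PROPOSITION D′(3N) and the descent (`HodgeFermat/PropDPrimeNFinal.lean`, GATE HF-G34), the last off-gate form of THEOREM F*
(its first two forms, `DecodingFinal.thmFstar` = F* at the prime levels and `ThmFstarNFinal.thmFstar` = F*(3N), landed on
2026-08-25 as `HodgeFermatThmFstar.lean` / `HodgeFermatThmFstarN.lean`, seats prover-1 gen-0 / gen-2); this file is one link of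
the import closure of `PropDPrimeNFinal.propDprime` (the sibling's KR-free chain: THEOREM L, COROLLARY M, THEOREM D6,
THEOREM U⁺, THEOREM KR6, THEOREM Z3U) on top of those landed chains.  The source module is the sibling's hub-checked module of
record (pub-hodgefermat `CERT.md` l.882, GATE HF-G21g; cell record `check/TheoremD6_standalone.lean` sha256 `e3481f23a610a68e…`); its declarations are copied VERBATIM.
Deviations from the source module, exhaustively: the `import` lines (tree modules `Summits.HodgeConjecture.FermatCycles.
HodgeFermat*` instead of `HodgeFermat.*`); this module docstring; the three re-binding lines `open HodgeFermat.KRFree.Decoding renaming st_symm → sameType_symm, st_trans → sameType_trans, st_swap → sameType_swap, st_rot → sameType_rot, unit_mul_not_dvd → not_dvd_unit_mul` / `open HodgeFermat.KRFree.Decoding (rsum_swap rsum_rot)` / `open HodgeFermat.KRFree.TheoremZ3U renaming not_dvd_cofactor' → not_dvd_cofactor, rsum_const₃ → rsum_const_of_dvd` are added after the source's `open` (the module used the deleted `Bridge`/`TheoremL` copies); DEDUP (pre-empting the gate's `dedup.landed`): the source's `lemma not_dvd_cofactor` (l.144–150) is VERBATIM (up to names) `HodgeFermat.KRFree.TheoremZ3U.not_dvd_cofactor'`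 of `HodgeFermatTheoremZ3UA.lean` and is DELETED (re-bound by the third line); one-line docstrings added (gate lint) to `pos_right`, `dvd_second`, `dvd_first`, `disj_descend`, `Setting.pos`, `Setting.odd`, `Setting.hsum`, `Setting.hsum'`, `fact_contra`; the file ends at source l.287 with an `end` line (part 2 = `HodgeFermatTheoremD6B.lean`).
Every other line — in particular every declaration's statement and proof — is byte-identical to the source.
HONEST FRAMING: explicit algebraic cycles for specific Hodge classes on Fermat/Delsarte varieties; residual open instances
listed; no claim on general Hodge.  (This file is arithmetic of CM types / finite combinatorics / analytic number theory
of the sibling's KR-free programme; it claims nothing about cycles.)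

The source module's docstring (TheoremD6.lean l.5–54), verbatim:

## THEOREM D6 — the assembly (`tables/KR-FREE.md` §7), kernel-checked modulo PROPOSITION L7(c) and THEOREM U

THEOREM D6 (`tables/KR-FREE.md`): at a squarefree level `N` prime to 6 there is no DISJOINT coincidence,
i.e. no pair of triples `T = (a, b, c)`, `T' = (a', b', c')` of level `N` (entry sums divisible by `N`,
no entry divisible by `N`), with no entry of `T` congruent mod `N` to an entry of `T'`, and with the same
CM type (`SameType N T T'`: `H_T ∩ (ℤ/N)ˣ = H_{T'} ∩ (ℤ/N)ˣ`).

This file formalises the PROOF OF THEOREM D6 of `tables/KR-FREE.md` §7 — the reduction to a jointly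
primitive pair (§1 there) and the prime-by-prime pattern analysis — on top of the pieces already in the
kernel:

* the rows of THEOREM L (`TheoremLRows.lean`, `TheoremL13.lean`): (Z3,U) `row_Z3U`, (Z3,Z1)
  `row_Z3Z1_seven` / `row_Z3Z1_five_not3`, (Z1,Z1) `row_Z1Z1_eleven`, (U,Z1) `row_UZ1_ge_eleven_not3`;
* PROPOSITION L7(a) at `3 ∤ n` (`PropL7a.lean`: `row_UZ1_seven_not3`, and the descent tools
  `sameType_descend`, `z3_vs_any`);
* PROPOSITION L5 (`PropL5.lean`: `propL5`) and PROPOSITION Z5 (`PropZ5.lean`: `propZ5`);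
* the finite facts F5, F35, F55, F65, F85, F95 (`KRFreeFacts.lean`) through the bridge
  `Bridge.coincidenceFree_first`.

The two inputs of §7 that are NOT (yet) formalised enter as named hypotheses, stated as `Prop`s in exactly
the form in which the proof consumes them:

* `PropL7c` — PROPOSITION L7(c) (`tables/KR-FREE.md` §3; proved there with LEMMA CC): at a squarefree
  level `7n` prime to 6, a disjoint jointly primitive pair of pattern (Z1, Z1) at 7 does not have equal types;
* `ThmU` — THEOREM U (`tables/SEMI-THEOREM.md` §2; proved there with LEMMA S) in consequence form at
  levels prime to 6: two all-unit triples with the same type share an entry mod `N` (THEOREM U gives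
  `T = T'` outright for squarefree odd `N ∉ {21, 39}`).

Main results (namespace `HodgeFermat.KRFree.TheoremD6`):

* `d6_primitive : PropL7c → ThmU → Setting N (a,b,c) (a',b',c') → False` — the jointly primitive case
  (`Setting` bundles: `N` squarefree, `2 ∤ N`, `3 ∤ N`, the two entry sums divisible by `N`, the six
  entries non-zero mod `N`, joint primitivity `JP`, disjointness `Disj`, `SameType`);
* `theoremD6_of : PropL7c → ThmU → D6` — THEOREM D6 itself (`D6` = the statement above for
  every pair, joint primitivity NOT assumed: the proof divides out `gcd(N, T, T')` by strong induction on
  `N`, using `sameType_descend`).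

Structure of the proof (= §7): `noZ3` (no prime of `N` divides a whole triple: `z3_vs_any` for `q ≥ 7`,
`z3_vs_any5` at `q = 5` from `row_Z3U` + `row_Z3Z1_five_not3`, joint primitivity for (Z3,Z3));
`no_UZ1_ge7` ((U,Z1) at `q ≥ 11`: `row_UZ1_ge_eleven_not3`; at `q = 7`: `row_UZ1_seven_not3`);
`no_Z1Z1_ge7` ((Z1,Z1) at `q ≥ 11`: `row_Z1Z1_eleven`, disjointness giving `ȳ ≠ ȳ'`; at `q = 7`:
`PropL7c`); `elim_ge7` (a prime `q ≥ 7` dividing an entry is impossible); `coprime_of` (hence every entry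
is prime to `N/5`); `elim5` (a multiple of 5: (U,Z1) at 5 is `propL5`, (Z1,Z1) at 5 is `propZ5`, both for
`N > 100`, the levels `N ≤ 100` being F5 … F95 via `fact_contra`); `d6_primitive` (all six entries units
⇒ `ThmU` contradicts disjointness; else some prime of `N` divides an entry ⇒ `elim_ge7` / `elim5` after
permuting that entry to the front); `theoremD6_of` (descent).

No `sorry`, no `native_decide`; axioms `propext`, `Classical.choice`, `Quot.sound` only.
-/

set_option autoImplicit false

namespace HodgeFermat.KRFree.TheoremD6

open HodgeFermat.KRFree HodgeFermat.KRFree.LemmaN HodgeFermat.KRFree.LemmaO HodgeFermat.KRFree.TheoremL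
  HodgeFermat.KRFree.Bridge
open HodgeFermat.KRFree.Decoding renaming st_symm → sameType_symm, st_trans → sameType_trans, st_swap → sameType_swap, st_rot → sameType_rot, unit_mul_not_dvd → not_dvd_unit_mul
open HodgeFermat.KRFree.Decoding (rsum_swap rsum_rot)
open HodgeFermat.KRFree.TheoremZ3U renaming not_dvd_cofactor' → not_dvd_cofactor, rsum_const₃ → rsum_const_of_dvd


/-! ## The setting: disjointness, joint primitivity, the standing hypotheses -/

/-- `x` is not congruent mod `N` to any entry of `T'` -/
def NotIn (N x : ℕ) (T' : ℕ × ℕ × ℕ) : Prop :=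
  ¬ x ≡ T'.1 [MOD N] ∧ ¬ x ≡ T'.2.1 [MOD N] ∧ ¬ x ≡ T'.2.2 [MOD N]

/-- the pair `(T, T')` is DISJOINT: no entry of `T` is congruent mod `N` to an entry of `T'` -/
def Disj (N : ℕ) (T T' : ℕ × ℕ × ℕ) : Prop :=
  NotIn N T.1 T' ∧ NotIn N T.2.1 T' ∧ NotIn N T.2.2 T'

/-- the pair `(T, T')` is JOINTLY PRIMITIVE: no prime factor of the level divides all six entries -/
def JP (N : ℕ) (T T' : ℕ × ℕ × ℕ) : Prop :=
  ∀ q, Nat.Prime q → q ∣ N → q ∣ T.1 → q ∣ T.2.1 → q ∣ T.2.2 → q ∣ T'.1 → q ∣ T'.2.1 → q ∣ T'.2.2 → False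

/-- THEOREM D6 as a proposition: no disjoint coincidence at a squarefree level prime to 6. -/
def D6 : Prop :=
  ∀ N a b c a' b' c' : ℕ, Squarefree N → ¬ 2 ∣ N → ¬ 3 ∣ N →
    N ∣ a + b + c → N ∣ a' + b' + c' →
    ¬ N ∣ a → ¬ N ∣ b → ¬ N ∣ c → ¬ N ∣ a' → ¬ N ∣ b' → ¬ N ∣ c' →
    Disj N (a, b, c) (a', b', c') → SameType N (a, b, c) (a', b', c') → False

/-- PROPOSITION L7(c) of `tables/KR-FREE.md` §3 (hypothesis; proved there by hand with LEMMA CC): at a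
squarefree level `7n` prime to 6, a disjoint jointly primitive pair `T = (7y, x₂, x₃)`, `T' = (7y', x₂', x₃')`
of pattern (Z1, Z1) at 7 (`7 ∤ x₂ x₃ x₂' x₃'`, `7y, 7y' ≢ 0`) does not have equal CM types. -/
def PropL7c : Prop :=
  ∀ n y x₂ x₃ y' x₂' x₃' : ℕ, Squarefree n → ¬ 7 ∣ n → ¬ 3 ∣ n → Odd n →
    7 * n ∣ 7 * y + x₂ + x₃ → ¬ 7 ∣ x₂ → ¬ 7 ∣ x₃ → ¬ n ∣ y →
    7 * n ∣ 7 * y' + x₂' + x₃' → ¬ 7 ∣ x₂' → ¬ 7 ∣ x₃' → ¬ n ∣ y' →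
    JP (7 * n) (7 * y, x₂, x₃) (7 * y', x₂', x₃') →
    Disj (7 * n) (7 * y, x₂, x₃) (7 * y', x₂', x₃') →
    SameType (7 * n) (7 * y, x₂, x₃) (7 * y', x₂', x₃') → False

/-- THEOREM U of `tables/SEMI-THEOREM.md` §2 in the (weaker) form consumed by §7 (hypothesis; proved there by
hand with LEMMA S): at a squarefree level prime to 6, two triples all of whose six entries are units and
which have the same CM type share an entry mod `N` (THEOREM U: they are even equal). -/
def ThmU : Prop :=
  ∀ N a b c a' b' c' : ℕ, Squarefree N → ¬ 2 ∣ N → ¬ 3 ∣ N →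
    N ∣ a + b + c → N ∣ a' + b' + c' →
    Nat.Coprime a N → Nat.Coprime b N → Nat.Coprime c N →
    Nat.Coprime a' N → Nat.Coprime b' N → Nat.Coprime c' N →
    SameType N (a, b, c) (a', b', c') → (a ≡ a' [MOD N] ∨ a ≡ b' [MOD N] ∨ a ≡ c' [MOD N])

/-- the standing hypotheses of §7 on a pair of triples at level `N`, jointly primitive case -/
structure Setting (N : ℕ) (T T' : ℕ × ℕ × ℕ) : Prop where
  sq : Squarefree N
  two : ¬ 2 ∣ N
  three : ¬ 3 ∣ N
  sum : N ∣ T.1 + T.2.1 + T.2.2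
  sum' : N ∣ T'.1 + T'.2.1 + T'.2.2
  nz₁ : ¬ N ∣ T.1
  nz₂ : ¬ N ∣ T.2.1
  nz₃ : ¬ N ∣ T.2.2
  nz₁' : ¬ N ∣ T'.1
  nz₂' : ¬ N ∣ T'.2.1
  nz₃' : ¬ N ∣ T'.2.2
  jp : JP N T T'
  disj : Disj N T T'
  same : SameType N T T'

/-! ## Elementary lemmas -/

/-- the right factor of a positive product is positive -/
lemma pos_right {q n : ℕ} (h : 0 < q * n) : 0 < n := by
  rcases Nat.eq_zero_or_pos n with h0 | h0
  · simp [h0] at h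
  · exact h0

/-- two entries divisible by `q ∣ M` force the third (`M ∣ a + b + c`) -/
lemma dvd_third {q M a b c : ℕ} (hq : q ∣ M) (hs : M ∣ a + b + c) (ha : q ∣ a) (hb : q ∣ b) : q ∣ c := by
  have h1 : q ∣ a + b + c := dvd_trans hq hs
  have h2 : q ∣ a + b := dvd_add ha hb
  have h : q ∣ a + b + c - (a + b) := Nat.dvd_sub h1 h2
  rwa [show a + b + c - (a + b) = c by omega] at h

/-- if `q` divides the level, the sum and two entries, it divides the second entry -/
lemma dvd_second {q M a b c : ℕ} (hq : q ∣ M) (hs : M ∣ a + b + c) (ha : q ∣ a) (hc : q ∣ c) : q ∣ b := by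
  have hs' : M ∣ a + c + b := by rwa [show a + c + b = a + b + c by ring]
  exact dvd_third hq hs' ha hc

/-- if `q` divides the level, the sum and two entries, it divides the first entry -/
lemma dvd_first {q M a b c : ℕ} (hq : q ∣ M) (hs : M ∣ a + b + c) (hb : q ∣ b) (hc : q ∣ c) : q ∣ a := by
  have hs' : M ∣ b + c + a := by rwa [show b + c + a = a + b + c by ring]
  exact dvd_third hq hs' hb hc


/-- joint primitivity in the `gcd = 1` form used by `row_UZ1_seven_not3` -/
lemma gcd_chain_eq_one {N a b c a' b' c' : ℕ} (h : JP N (a, b, c) (a', b', c')) :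
    Nat.gcd N (Nat.gcd a (Nat.gcd b (Nat.gcd c (Nat.gcd a' (Nat.gcd b' c'))))) = 1 := by
  by_contra hne
  have hq := Nat.minFac_prime hne
  have hd : Nat.minFac (Nat.gcd N (Nat.gcd a (Nat.gcd b (Nat.gcd c (Nat.gcd a' (Nat.gcd b' c')))))) ∣
      Nat.gcd N (Nat.gcd a (Nat.gcd b (Nat.gcd c (Nat.gcd a' (Nat.gcd b' c'))))) := Nat.minFac_dvd _
  simp only [Nat.dvd_gcd_iff] at hd
  obtain ⟨h0, h1, h2, h3, h4, h5, h6⟩ := hd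
  exact h _ hq h0 h1 h2 h3 h4 h5 h6

/-- `Disj` descends along division of the level and all entries by `q` -/
lemma disj_descend {q N₁ a b c a' b' c' : ℕ}
    (h : Disj (q * N₁) (q * a, q * b, q * c) (q * a', q * b', q * c')) :
    Disj N₁ (a, b, c) (a', b', c') :=
  ⟨⟨fun e => h.1.1 (Nat.ModEq.mul_left' q e), fun e => h.1.2.1 (Nat.ModEq.mul_left' q e),
    fun e => h.1.2.2 (Nat.ModEq.mul_left' q e)⟩,
   ⟨fun e => h.2.1.1 (Nat.ModEq.mul_left' q e), fun e => h.2.1.2.1 (Nat.ModEq.mul_left' q e),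
    fun e => h.2.1.2.2 (Nat.ModEq.mul_left' q e)⟩,
   ⟨fun e => h.2.2.1 (Nat.ModEq.mul_left' q e), fun e => h.2.2.2.1 (Nat.ModEq.mul_left' q e),
    fun e => h.2.2.2.2 (Nat.ModEq.mul_left' q e)⟩⟩

/-! ## The setting is symmetric and permutation invariant -/

namespace Setting

variable {N a b c a' b' c' : ℕ}

/-- the level of a `Setting` is positive -/
lemma pos (S : Setting N (a, b, c) (a', b', c')) : 0 < N :=
  Nat.pos_of_ne_zero (fun h => by subst h; exact not_squarefree_zero S.sq)

/-- the level of a `Setting` is odd -/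
lemma odd (S : Setting N (a, b, c) (a', b', c')) : Odd N :=
  Nat.odd_iff.mpr (by have := S.two; omega)

/-- the first triple of a `Setting` is zero-sum -/
lemma hsum (S : Setting N (a, b, c) (a', b', c')) : N ∣ a + b + c := S.sum
/-- the second triple of a `Setting` is zero-sum -/
lemma hsum' (S : Setting N (a, b, c) (a', b', c')) : N ∣ a' + b' + c' := S.sum'

/-- interchange the two triples -/
lemma symm (S : Setting N (a, b, c) (a', b', c')) : Setting N (a', b', c') (a, b, c) where
  sq := S.sq
  two := S.two
  three := S.three
  sum := S.sum'
  sum' := S.sum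
  nz₁ := S.nz₁'
  nz₂ := S.nz₂'
  nz₃ := S.nz₃'
  nz₁' := S.nz₁
  nz₂' := S.nz₂
  nz₃' := S.nz₃
  jp := fun q hq hqN h1 h2 h3 h4 h5 h6 => S.jp q hq hqN h4 h5 h6 h1 h2 h3
  disj := ⟨⟨fun e => S.disj.1.1 e.symm, fun e => S.disj.2.1.1 e.symm, fun e => S.disj.2.2.1 e.symm⟩,
    ⟨fun e => S.disj.1.2.1 e.symm, fun e => S.disj.2.1.2.1 e.symm, fun e => S.disj.2.2.2.1 e.symm⟩,
    ⟨fun e => S.disj.1.2.2 e.symm, fun e => S.disj.2.1.2.2 e.symm, fun e => S.disj.2.2.2.2 e.symm⟩⟩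
  same := sameType_symm S.same

/-- swap the first two entries of the first triple -/
lemma swap12 (S : Setting N (a, b, c) (a', b', c')) : Setting N (b, a, c) (a', b', c') where
  sq := S.sq
  two := S.two
  three := S.three
  sum := by have h := S.hsum; rwa [show a + b + c = b + a + c by ring] at h
  sum' := S.sum'
  nz₁ := S.nz₂
  nz₂ := S.nz₁
  nz₃ := S.nz₃
  nz₁' := S.nz₁'
  nz₂' := S.nz₂'
  nz₃' := S.nz₃'
  jp := fun q hq hqN h1 h2 h3 h4 h5 h6 => S.jp q hq hqN h2 h1 h3 h4 h5 h6
  disj := ⟨S.disj.2.1, S.disj.1, S.disj.2.2⟩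
  same := by
    have hs : N ∣ b + a + c := by have h := S.hsum; rwa [show a + b + c = b + a + c by ring] at h
    exact sameType_trans (sameType_swap S.pos hs S.nz₃) S.same

/-- rotate the first triple: bring its last entry to the front -/
lemma rot (S : Setting N (a, b, c) (a', b', c')) : Setting N (c, a, b) (a', b', c') where
  sq := S.sq
  two := S.two
  three := S.three
  sum := by have h := S.hsum; rwa [show a + b + c = c + a + b by ring] at h
  sum' := S.sum'
  nz₁ := S.nz₃
  nz₂ := S.nz₁
  nz₃ := S.nz₂
  nz₁' := S.nz₁'
  nz₂' := S.nz₂'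
  nz₃' := S.nz₃'
  jp := fun q hq hqN h1 h2 h3 h4 h5 h6 => S.jp q hq hqN h2 h3 h1 h4 h5 h6
  disj := ⟨S.disj.2.2, S.disj.1, S.disj.2.1⟩
  same := sameType_trans (sameType_symm (sameType_rot S.pos S.hsum S.nz₂ S.nz₃)) S.same

/-- swap the first two entries of the second triple -/
lemma swap12' (S : Setting N (a, b, c) (a', b', c')) : Setting N (a, b, c) (b', a', c') :=
  S.symm.swap12.symm

/-- rotate the second triple -/
lemma rot' (S : Setting N (a, b, c) (a', b', c')) : Setting N (a, b, c) (c', a', b') :=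
  S.symm.rot.symm

end Setting

/-! ## The finite levels: F5, F35, F55, F65, F85, F95 through the bridge -/

/-- a `Setting` at a coincidence-free level is contradictory -/
lemma fact_contra {N a b c a' b' c' : ℕ} (hF : CoincidenceFree N) (S : Setting N (a, b, c) (a', b', c')) :
    False := by
  rcases coincidenceFree_first hF S.pos a b c a' b' c' S.hsum S.hsum' S.nz₁ S.nz₂ S.nz₃ S.nz₁' S.nz₂'
    S.nz₃' S.same with h | h | h
  · exact S.disj.1.1 h
  · exact S.disj.1.2.1 h
  · exact S.disj.1.2.2 h

/-- the levels `N = 5n ≤ 100` of the setting are `5, 35, 55, 65, 85, 95`, all coincidence-free in the kernel -/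
lemma small5 {n a b c a' b' c' : ℕ} (S : Setting (5 * n) (a, b, c) (a', b', c')) (hn : n ≤ 20) : False := by
  interval_cases n
  · exact absurd S.pos (by norm_num)
  · exact fact_contra F5 S
  · exact S.two (by norm_num)
  · exact S.three (by norm_num)
  · exact S.two (by norm_num)
  · exact absurd (Nat.isUnit_iff.mp (S.sq 5 (by norm_num))) (by norm_num)
  · exact S.two (by norm_num)
  · exact fact_contra F35 S
  · exact S.two (by norm_num)
  · exact S.three (by norm_num)
  · exact S.two (by norm_num)
  · exact fact_contra F55 S
  · exact S.two (by norm_num)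
  · exact fact_contra F65 S
  · exact S.two (by norm_num)
  · exact S.three (by norm_num)
  · exact S.two (by norm_num)
  · exact fact_contra F85 S
  · exact S.two (by norm_num)
  · exact fact_contra F95 S
  · exact S.two (by norm_num)


end HodgeFermat.KRFree.TheoremD6
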